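import Literature.Probability.LatticeModels.AizenmanWickBound

/-!
# Aizenman's bound on the deviation from Wick's law: smearing a LOCAL pairing-form inequality

Topic `Literature/Probability/LatticeModels`; sibling of `AizenmanWickBound.lean` (Aizenman 1982,
Prop. 12.1 = Aizenman CDM 2020, Prop. 7.2 = Panis 2023, Prop. 4.6, in the printed pairing form
`|S_{2n} - 𝒢_n[S₂]| ≤ (3/2) R_{2n}`, `R_{2n} = ∑_{s} |U₄(x_s)| 𝒢_{n-2}[S₂](x^{(s̸)})` = `wickRemainder`).

`AizenmanWickBound.abs_integral_normalizedField_pow_sub_le_of_wickBounds` smears the inequality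
for a probability measure `μ` on `{±1}^{ℤ^d}` satisfying it (and Newman's lower bound) at ALL
`2n`-tuples of points of `ℤ^d`. A state that is only known through a finite window — e.g. the
free-boundary infinite-volume state of a long-range ferromagnet realised on the spins of a box,
`Literature/Barriers/CriticalPhenomena/LongRangeTrivialityOnZ3Wick.lean` — satisfies it only at
points of the window. This file proves the LOCAL version, which is all the smearing uses (the
smeared sums range over `Λ_{rL}^{2n}`), and drops the lower bound (the absolute values are moved
inside directly, `|∑ ∏f · (S - 𝒢)| ≤ ∑ ∏|f| · |S - 𝒢|`):

`abs_integral_normalizedField_pow_sub_le_of_wickDeviationBoundOn`: if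
`|S^μ_{2n}(x) - 𝒢_n[S₂^μ](x)| ≤ (3/2) R^μ_{2n}(x)` for all `n ≥ 2` and all `x ∈ Λ_{rL}^{2n}`, then for
`L > 0`, `f` continuous vanishing off `[-r,r]^d` and `n ≥ 2`,
`|⟨T_{f,L}^{2n}⟩ - (2n)!/(2ⁿn!)⟨T_{f,L}²⟩ⁿ|
   ≤ (3/2)(2n)⁴ ‖f‖_∞⁴ S(μ;L,r) · (2n-4)!/(2^{n-2}(n-2)!) ⟨T_{|f|,L}²⟩^{n-2}`
(Aizenman CDM 2020, (7.6), (7.9)–(7.10); Panis 2023, proof of Thm. 5.5, first display, in the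
form Prop. 4.6 yields).

It also records, as theorems, that the `S_{2n-4}` form of the inequality quoted by
Aizenman–Duminil-Copin 2021, §6.3 (vendored in `HighDimTrivialityWick` as `PairingUpperBound`,
`aizenman_pairingSum_sub_nPoint_le(_finite)`) is FALSE: at ten coincident points it would read
`944 ≤ 630` (`not_pairingUpperBound_at_zero`, `not_pairingUpperBound` for every probability measure,
`not_aizenman_pairingSum_sub_nPoint_le_finite`). The sibling file `AizenmanWickBound` already
re-derives everything downstream from the printed pairing form. No new definitions.

## References

* M. Aizenman, Comm. Math. Phys. 86 (1982), Prop. 12.1 [AizenmanCMP1982] (through the sibling file).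
* M. Aizenman, CDM 2020 = arXiv:2112.04248, Prop. 7.2, (7.6)–(7.10) [AizenmanCDM2020] (read).
* R. Panis, arXiv:2309.05797, Prop. 4.6 and proof of Thm. 5.5 (p. 21) [Panis2023Triviality] (read).
-/

noncomputable section

open MeasureTheory Finset Filter
open scoped Nat

namespace Literature.Probability.LatticeModels

variable {d : ℕ}

/-- **Smearing the pairing-form inequality assumed on `Λ_{rL}` only.** Suppose the correlation
functions of the probability measure `μ` on `{±1}^{ℤ^d}` satisfy, for all `n ≥ 2` and all
`x₁,…,x_{2n} ∈ Λ_{rL}`, `|S_{2n}(x) - 𝒢_n[S₂](x)| ≤ (3/2) R_{2n}(x)` (Aizenman 1982, Prop. 12.1;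
Aizenman CDM 2020, Prop. 7.2; Panis 2023, Prop. 4.6; `R_{2n} = wickRemainder`). Then for `L > 0`,
`f` continuous vanishing off `[-r,r]^d` and `n ≥ 2`,
`|⟨T_{f,L}^{2n}⟩ - (2n)!/(2ⁿn!) ⟨T_{f,L}²⟩ⁿ|
  ≤ (3/2)(2n)⁴ ‖f‖_∞⁴ S(μ;L,r) · (2n-4)!/(2^{n-2}(n-2)!) ⟨T_{|f|,L}²⟩^{n-2}`:
multiply the pointwise inequality by `∏ᵢ f(xᵢ/L)`, take absolute values inside, factor the sum over
`x ∈ Λ_{rL}^{2n}` along each `4`-subset of the indices (`C(2n,4) ≤ (2n)⁴`), and evaluate the smeared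
Wick functional of the remaining `2n-4` points as the Gaussian moment
`(2n-4)!/(2^{n-2}(n-2)!)⟨T_{|f|,L}²⟩^{n-2}` (`sum_prod_mul_pairingSum`). Same conclusion as
`abs_integral_normalizedField_pow_sub_le_of_wickBounds`, without the lower bound and with the
hypothesis restricted to the points the smeared sums see.
[cite: AizenmanCDM2020, Prop. 7.2 and §7 eqs. (7.6), (7.9)–(7.10)] [cite: Panis2023Triviality, Prop. 4.6 and proof of Thm. 5.5, first display (p. 21)] -/
theorem abs_integral_normalizedField_pow_sub_le_of_wickDeviationBoundOn
    {μ : Measure (SpinConfig (Site d))} [IsProbabilityMeasure μ] {L r : ℝ} (hL : 0 < L)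
    (hW : ∀ n : ℕ, 2 ≤ n → ∀ x : Fin (2 * n) → Site d, (∀ i, x i ∈ latticeBox d (r * L)) →
      |nPoint μ spinAt x - pairingSum (twoPoint μ spinAt) n x| ≤
        3 / 2 * wickRemainder (twoPoint μ spinAt) (connectedFour μ spinAt) n x)
    {f : EuclideanSpace ℝ (Fin d) → ℝ} (hf : Continuous f) (hfr : ∀ x, f x ≠ 0 → ∀ i, |x i| ≤ r)
    {n : ℕ} (hn : 2 ≤ n) :
    |(∫ σ, normalizedField μ L f σ ^ (2 * n) ∂μ) -
        ((2 * n)! : ℝ) / (2 ^ n * n !) * (∫ σ, normalizedField μ L f σ ^ 2 ∂μ) ^ n|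
      ≤ 3 / 2 * (2 * n : ℝ) ^ 4 * (⨆ x, |f x|) ^ 4 * ursellFourSum μ L r *
          (((2 * (n - 2))! : ℝ) / (2 ^ (n - 2) * (n - 2)!) *
            (∫ σ, normalizedField μ L (fun x => |f x|) σ ^ 2 ∂μ) ^ (n - 2)) := by
  have hLne : L ≠ 0 := hL.ne'
  have hfar : ∀ x, (fun y => |f y|) x ≠ 0 → ∀ i, |x i| ≤ r := fun x hx =>
    hfr x (abs_ne_zero.mp hx)
  have hbox : latticeBox d (r / |L⁻¹|) = latticeBox d (r * L) := by
    rw [abs_inv, abs_of_pos hL, div_inv_eq_mul]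
  -- notation
  set Λ : Finset (Site d) := latticeBox d (r / |L⁻¹|) with hΛ
  set c : ℝ := (Real.sqrt (blockSpinVariance μ L))⁻¹ with hc
  set g : Site d → ℝ := fun a => f (L⁻¹ • siteVec a) with hg
  set S₂ : Site d → Site d → ℝ := twoPoint μ spinAt with hS₂
  set G : (Fin (2 * n) → Site d) → ℝ := fun p => pairingSum S₂ n p with hG
  set U : (Fin 4 → Site d) → ℝ := fun u => connectedFour μ spinAt u with hU
  set P : (Fin (2 * n - 4) → Site d) → ℝ := fun q =>
    pairingSum S₂ (n - 2) (q ∘ Fin.cast (two_mul_sub_two n)) with hP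
  set γ : ℝ := ((2 * (n - 2))! : ℝ) / (2 ^ (n - 2) * (n - 2)!) with hγ
  set A : ℝ := ∑ q ∈ Fintype.piFinset (fun _ : Fin (2 * n - 4) => Λ), (∏ j, |g (q j)|) * P q
    with hA
  set B : ℝ := ∑ u ∈ Fintype.piFinset (fun _ : Fin 4 => Λ), (∏ j, |g (u j)|) * |U u| with hB
  set Us : ℝ := ∑ u ∈ Fintype.piFinset (fun _ : Fin 4 => Λ), |U u| with hUs
  set V₂ : ℝ := ∑ a ∈ Λ, ∑ b ∈ Λ, |g a| * |g b| * S₂ a b with hV₂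
  set M : ℝ := ⨆ x, |f x| with hM
  have hM0 : 0 ≤ M := iSup_abs_nonneg f
  have hgM : ∀ a, |g a| ≤ M := by
    have hbdd : BddAbove (Set.range fun x => |f x|) :=
      (hf.abs).bddAbove_range_of_hasCompactSupport
        ((hasCompactSupport_of_cube hfr).comp_left abs_zero)
    intro a
    exact le_ciSup hbdd _
  have hc0 : 0 ≤ c := inv_nonneg.mpr (Real.sqrt_nonneg _)
  have hγ0 : 0 ≤ γ := by rw [hγ]; positivity
  have hSig0 : 0 ≤ blockSpinVariance μ L := integral_nonneg fun σ => sq_nonneg _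
  have hB0 : 0 ≤ B := Finset.sum_nonneg fun u _ =>
    mul_nonneg (Finset.prod_nonneg fun j _ => abs_nonneg _) (abs_nonneg _)
  -- the smeared Wick functional of the remaining points and the second moment of `T_{|f|,L}`
  have hAeq : A = γ * V₂ ^ (n - 2) := by
    rw [hA, hγ, hV₂, hP, sum_piFinset_prod_mul_comp_cast (two_mul_sub_two n) Λ (fun a => |g a|)
      (pairingSum S₂ (n - 2))]
    exact sum_prod_mul_pairingSum Λ (fun a => |g a|) S₂ (n - 2)
  have hmom2 : ∫ σ, normalizedField μ L (fun x => |f x|) σ ^ 2 ∂μ = c ^ 2 * V₂ := by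
    rw [integral_normalizedField_sq_eq_sum₂ μ hLne hfar]
  have hmom2_0 : 0 ≤ ∫ σ, normalizedField μ L (fun x => |f x|) σ ^ 2 ∂μ :=
    integral_nonneg fun σ => sq_nonneg _
  have hS : ursellFourSum μ L r = Us / blockSpinVariance μ L ^ 2 := by
    rw [ursellFourSum, hUs, hbox]
  have hS0 : 0 ≤ ursellFourSum μ L r := ursellFourSum_nonneg μ L r
  have hBle : B ≤ M ^ 4 * Us := by
    rw [hB, hUs, Finset.mul_sum]
    refine Finset.sum_le_sum fun u _ => ?_
    have hprod : ∏ j, |g (u j)| ≤ M ^ 4 := by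
      calc ∏ j, |g (u j)| ≤ ∏ _j : Fin 4, M :=
            Finset.prod_le_prod (fun j _ => abs_nonneg _) fun j _ => hgM _
        _ = M ^ 4 := by rw [Finset.prod_const, Finset.card_univ, Fintype.card_fin]
    exact mul_le_mul_of_nonneg_right hprod (abs_nonneg _)
  -- the right-hand side is non-negative
  have h30 : (0 : ℝ) ≤ 3 / 2 * (2 * n : ℝ) ^ 4 := by positivity
  have hRHS0 : 0 ≤ 3 / 2 * (2 * n : ℝ) ^ 4 * M ^ 4 * ursellFourSum μ L r *
      (γ * (∫ σ, normalizedField μ L (fun x => |f x|) σ ^ 2 ∂μ) ^ (n - 2)) :=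
    mul_nonneg (mul_nonneg (mul_nonneg h30 (pow_nonneg hM0 4)) hS0)
      (mul_nonneg hγ0 (pow_nonneg hmom2_0 _))
  -- Step 1: the deviation identity
  rw [integral_normalizedField_pow_sub_wick μ hLne hfr n, ← hc, ← hΛ]
  -- Step 2: absolute values inside, the pointwise bound, factorisation along each 4-subset
  have hmem : ∀ p ∈ Fintype.piFinset (fun _ : Fin (2 * n) => Λ), ∀ i, p i ∈ latticeBox d (r * L) := by
    intro p hp i
    rw [← hbox]
    exact Fintype.mem_piFinset.mp hp i
  have hR : ∀ p : Fin (2 * n) → Site d, wickRemainder S₂ (connectedFour μ spinAt) n p =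
      ∑ s : {s : Finset (Fin (2 * n)) // s.card = 4}, |U (restrictFour p s)| * P (removeFour p s) :=
    fun p => rfl
  have hsum : |∑ p ∈ Fintype.piFinset (fun _ : Fin (2 * n) => Λ),
      (∏ i, g (p i)) * (nPoint μ spinAt p - G p)| ≤
      3 / 2 * ((Fintype.card {s : Finset (Fin (2 * n)) // s.card = 4} : ℝ) * (A * B)) := by
    calc |∑ p ∈ Fintype.piFinset (fun _ : Fin (2 * n) => Λ),
          (∏ i, g (p i)) * (nPoint μ spinAt p - G p)|
        ≤ ∑ p ∈ Fintype.piFinset (fun _ : Fin (2 * n) => Λ),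
            (∏ i, |g (p i)|) * |nPoint μ spinAt p - G p| := by
          refine (Finset.abs_sum_le_sum_abs _ _).trans (le_of_eq (Finset.sum_congr rfl fun p _ => ?_))
          rw [abs_mul, Finset.abs_prod]
      _ ≤ ∑ p ∈ Fintype.piFinset (fun _ : Fin (2 * n) => Λ),
            (∏ i, |g (p i)|) * (3 / 2 * ∑ s : {s : Finset (Fin (2 * n)) // s.card = 4},
              |U (restrictFour p s)| * P (removeFour p s)) :=
          Finset.sum_le_sum fun p hp => mul_le_mul_of_nonneg_left
            (by rw [← hR p]; exact hW n hn p (hmem p hp))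
            (Finset.prod_nonneg fun i _ => abs_nonneg _)
      _ = 3 / 2 * ∑ s : {s : Finset (Fin (2 * n)) // s.card = 4},
            ∑ p ∈ Fintype.piFinset (fun _ : Fin (2 * n) => Λ),
              (∏ i, |g (p i)|) * (P (removeFour p s) * |U (restrictFour p s)|) := by
          rw [Finset.sum_comm, Finset.mul_sum]
          refine Finset.sum_congr rfl fun p _ => ?_
          rw [Finset.mul_sum, Finset.mul_sum, Finset.mul_sum]
          refine Finset.sum_congr rfl fun s _ => ?_
          ring
      _ = 3 / 2 * ∑ _s : {s : Finset (Fin (2 * n)) // s.card = 4}, A * B := by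
          congr 1
          refine Finset.sum_congr rfl fun s _ => ?_
          rw [sum_prod_mul_removeFour_mul_restrictFour Λ (fun a => |g a|) P (fun u => |U u|) s]
      _ = 3 / 2 * ((Fintype.card {s : Finset (Fin (2 * n)) // s.card = 4} : ℝ) * (A * B)) := by
          rw [Finset.sum_const, Finset.card_univ, nsmul_eq_mul]
  -- Step 3: the case `Σ_L = 0` (then `c = 0`)
  rcases hSig0.eq_or_lt with hSig | hSig
  · have hc' : c = 0 := by rw [hc, ← hSig, Real.sqrt_zero, inv_zero]
    rw [hc', zero_pow (by omega), zero_mul, abs_zero]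
    exact hRHS0
  -- Step 4: `Σ_L > 0`: normalise by `c^{2n} = (c²)^{n-2} c⁴`, `c⁴ = Σ_L⁻²`
  have hcpos : 0 < c := inv_pos.mpr (Real.sqrt_pos.mpr hSig)
  have hc4 : c ^ 4 = (blockSpinVariance μ L ^ 2)⁻¹ := by
    rw [hc, inv_pow, show (4 : ℕ) = 2 * 2 from rfl, pow_mul, Real.sq_sqrt hSig0]
  have hV₂0 : 0 ≤ V₂ := by
    have h := hmom2_0
    rw [hmom2] at h
    exact (mul_nonneg_iff_of_pos_left (pow_pos hcpos 2)).mp h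
  have hA0 : 0 ≤ A := by rw [hAeq]; exact mul_nonneg hγ0 (pow_nonneg hV₂0 _)
  have hcA0 : 0 ≤ (c ^ 2) ^ (n - 2) * A := mul_nonneg (pow_nonneg (pow_nonneg hc0 2) _) hA0
  have hcard := (card_fourSubsets_le (n := n))
  have hcsplit : c ^ (2 * n) = (c ^ 2) ^ (n - 2) * c ^ 4 := by
    rw [← pow_mul, ← pow_add]; congr 1; omega
  rw [abs_mul, abs_of_nonneg (pow_nonneg hc0 _), hcsplit]
  calc (c ^ 2) ^ (n - 2) * c ^ 4 * |∑ p ∈ Fintype.piFinset (fun _ : Fin (2 * n) => Λ),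
        (∏ i, g (p i)) * (nPoint μ spinAt p - G p)|
      ≤ (c ^ 2) ^ (n - 2) * c ^ 4 *
          (3 / 2 * ((Fintype.card {s : Finset (Fin (2 * n)) // s.card = 4} : ℝ) * (A * B))) :=
        mul_le_mul_of_nonneg_left hsum (mul_nonneg (pow_nonneg (pow_nonneg hc0 2) _) (pow_nonneg hc0 4))
    _ = 3 / 2 * (Fintype.card {s : Finset (Fin (2 * n)) // s.card = 4} : ℝ) *
          ((c ^ 2) ^ (n - 2) * A) * (c ^ 4 * B) := by ring
    _ ≤ 3 / 2 * (2 * n : ℝ) ^ 4 * ((c ^ 2) ^ (n - 2) * A) * (c ^ 4 * (M ^ 4 * Us)) :=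
        mul_le_mul (mul_le_mul_of_nonneg_right (mul_le_mul_of_nonneg_left hcard (by norm_num)) hcA0)
          (mul_le_mul_of_nonneg_left hBle (pow_nonneg hc0 4))
          (mul_nonneg (pow_nonneg hc0 4) hB0) (mul_nonneg h30 hcA0)
    _ = 3 / 2 * (2 * n : ℝ) ^ 4 * M ^ 4 * ursellFourSum μ L r *
          (γ * (∫ σ, normalizedField μ L (fun x => |f x|) σ ^ 2 ∂μ) ^ (n - 2)) := by
        rw [hmom2, hS, hc4, hAeq, div_eq_mul_inv, mul_pow]
        ring

/-- The global bound `WickDeviationBound μ` of `AizenmanWickBound` implies the local hypothesis,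
so `abs_integral_normalizedField_pow_sub_le_of_wickBounds` holds without its lower-bound
hypothesis. [cite: AizenmanCDM2020, Prop. 7.2 and §7 eq. (7.9)] -/
theorem abs_integral_normalizedField_pow_sub_le_of_wickDeviationBound
    {μ : Measure (SpinConfig (Site d))} [IsProbabilityMeasure μ] (hW : WickDeviationBound μ)
    {L r : ℝ} (hL : 0 < L) {f : EuclideanSpace ℝ (Fin d) → ℝ} (hf : Continuous f)
    (hfr : ∀ x, f x ≠ 0 → ∀ i, |x i| ≤ r) {n : ℕ} (hn : 2 ≤ n) :
    |(∫ σ, normalizedField μ L f σ ^ (2 * n) ∂μ) -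
        ((2 * n)! : ℝ) / (2 ^ n * n !) * (∫ σ, normalizedField μ L f σ ^ 2 ∂μ) ^ n|
      ≤ 3 / 2 * (2 * n : ℝ) ^ 4 * (⨆ x, |f x|) ^ 4 * ursellFourSum μ L r *
          (((2 * (n - 2))! : ℝ) / (2 ^ (n - 2) * (n - 2)!) *
            (∫ σ, normalizedField μ L (fun x => |f x|) σ ^ 2 ∂μ) ^ (n - 2)) :=
  abs_integral_normalizedField_pow_sub_le_of_wickDeviationBoundOn hL (fun m hm x _ => hW m hm x)
    hf hfr hn


/-! ### The `S_{2n-4}` form quoted by Aizenman–Duminil-Copin fails at coincident points -/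

/-- **The `S_{2n-4}` form of the upper inequality fails at ten coincident points, for every
probability measure on `{±1}^{ℤ^d}`.** With `x₁ = ⋯ = x_{10} = 0` (`n = 5`): `S_{10} = S_6 = 1`,
`S₂(0,0) = 1`, `𝒢_5[S₂] = 10!/(2⁵5!) = 945`, `U₄(0,0,0,0) = 1 - 3 = -2`, so
`𝒢_5 - S_{10} ≤ -(3/2) ∑_s S_6 U₄` would read `944 ≤ 630`. (The printed pairing form, Aizenman 1982,
Prop. 12.1 = `WickDeviationBound`, has `𝒢_3[S₂] = 15` for `S_6 = 1` on the right and reads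
`944 ≤ 9450` there.) [folklore] -/
theorem not_pairingUpperBound_at_zero (μ : Measure (SpinConfig (Site d))) [IsProbabilityMeasure μ] :
    ¬ (pairingSum (twoPoint μ spinAt) 5 (fun _ : Fin (2 * 5) => (0 : Site d)) -
          nPoint μ spinAt (fun _ : Fin (2 * 5) => (0 : Site d)) ≤
        -(3 / 2) * ∑ s : {s : Finset (Fin (2 * 5)) // s.card = 4},
          nPoint μ spinAt (removeFour (fun _ : Fin (2 * 5) => (0 : Site d)) s) *
            connectedFour μ spinAt (restrictFour (fun _ : Fin (2 * 5) => (0 : Site d)) s)) := by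
  intro key
  -- correlations at coincident points
  have hn : ∀ {m : ℕ}, Even m → nPoint μ spinAt (fun _ : Fin m => (0 : Site d)) = 1 := by
    intro m hm
    rw [nPoint]
    have hf : (fun σ : SpinConfig (Site d) => ∏ _i : Fin m, spinAt (0 : Site d) σ) = fun _ => 1 := by
      funext σ
      rw [Finset.prod_const, Finset.card_univ, Fintype.card_fin]
      obtain ⟨k, rfl⟩ := hm
      rw [← two_mul, pow_mul, pow_two, spinAt_mul_self, one_pow]
    rw [hf]
    simp
  have h2 : twoPoint μ spinAt (0 : Site d) 0 = 1 := twoPoint_spinAt_self μ 0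
  have hG : pairingSum (twoPoint μ spinAt) 5 (fun _ : Fin (2 * 5) => (0 : Site d)) = 945 := by
    unfold pairingSum
    simp only [h2, Finset.prod_const_one, Finset.sum_const, Finset.card_univ, Fintype.card_perm,
      Fintype.card_fin, nsmul_eq_mul, mul_one]
    norm_num [Nat.factorial]
  have hU : connectedFour μ spinAt (fun _ : Fin 4 => (0 : Site d)) = -2 := by
    rw [connectedFour, h2, hn ⟨2, rfl⟩]
    norm_num
  have hsum : ∑ s : {s : Finset (Fin (2 * 5)) // s.card = 4},
      nPoint μ spinAt (removeFour (fun _ : Fin (2 * 5) => (0 : Site d)) s) *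
        connectedFour μ spinAt (restrictFour (fun _ : Fin (2 * 5) => (0 : Site d)) s) = -420 := by
    have hterm : ∀ s : {s : Finset (Fin (2 * 5)) // s.card = 4},
        nPoint μ spinAt (removeFour (fun _ : Fin (2 * 5) => (0 : Site d)) s) *
          connectedFour μ spinAt (restrictFour (fun _ : Fin (2 * 5) => (0 : Site d)) s) = -2 := by
      intro s
      rw [show removeFour (fun _ : Fin (2 * 5) => (0 : Site d)) s = fun _ => 0 from rfl,
        show restrictFour (fun _ : Fin (2 * 5) => (0 : Site d)) s = fun _ => 0 from rfl,
        hn (by decide), hU, one_mul]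
    rw [Finset.sum_congr rfl fun s _ => hterm s, Finset.sum_const, Finset.card_univ,
      Fintype.card_finset_len, Fintype.card_fin, show Nat.choose (2 * 5) 4 = 210 by decide]
    norm_num
  rw [hG, hn (even_two_mul 5), hsum] at key
  norm_num at key

/-- **No probability measure on `{±1}^{ℤ^d}` satisfies `PairingUpperBound`** (the `S_{2n-4}` form
of the first display of Aizenman–Duminil-Copin 2021, §6.3, vendored in `HighDimTrivialityWick`,
Part J); in particular the named facts `aizenman_pairingSum_sub_nPoint_le` (for any Gibbs state that
exists) and, below, `aizenman_pairingSum_sub_nPoint_le_finite` cannot be discharged as stated — the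
dischargeable statement is the printed pairing form (`WickDeviationBound`,
`aizenman_wickDeviation_le_finite` of `AizenmanWickBound`). [folklore] -/
theorem not_pairingUpperBound (μ : Measure (SpinConfig (Site d))) [IsProbabilityMeasure μ] :
    ¬ PairingUpperBound μ :=
  fun h => not_pairingUpperBound_at_zero μ (h 5 (by norm_num) _)

-- names the `@[deprecated]` record `aizenman_pairingSum_sub_nPoint_le_finite` of `HighDimTrivialityWick.lean` on purpose: this IS its
-- refutation (verdict clean-up 2026-08-15); REMOVE-WHEN the record is deleted from `HighDimTrivialityWick.lean`
set_option linter.deprecated false in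
/-- **The tree's finite-volume named fact `aizenman_pairingSum_sub_nPoint_le_finite`
(`HighDimTrivialityWick`, Part M — the `S_{2n-4}` form in every finite volume) is false**: in
`Λ = {0} ⊂ ℤ¹` at `β = 0` the finite Gibbs measure is a probability measure and the ten coincident
points lie in `Λ`. [folklore] -/
theorem not_aizenman_pairingSum_sub_nPoint_le_finite :
    ¬ aizenman_pairingSum_sub_nPoint_le_finite :=
  fun h => not_pairingUpperBound_at_zero (isingMeasure (zdGraph 1) {0} 0 0 .free)
    (h {0} 0 le_rfl 5 (by norm_num) (fun _ => 0) fun _ => Finset.mem_singleton_self 0)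

end Literature.Probability.LatticeModels

end
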